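import Summits.QuantumFields.GaugeBoot.Targets
import Mathlib.LinearAlgebra.Matrix.SpecialLinearGroup
import Literature.NumberTheory.Automorphic.MatrixTwoConjugacy
import Mathlib.GroupTheory.FreeGroup.Basic
import HarnessLib

/-!
# The Fricke–Klein trace polynomial: `tr w(A,B)` on `SL(2, R)` depends only on `tr A`, `tr B`, `tr AB`
# (gauge-boot, large-`N` supplement 17, part 7 — the published generality of part 1)

HONEST FRAMING (cell `pub-gaugeboot`, page 1 of every file): the venture produces certified bounds
on lattice expectations at stated coupling, gauge group, dimension and torus size; NOT a mass gap,
NOT a continuum limit, NOT a string tension; NOT large `N` unless marked CONDITIONAL; NOT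
Yang–Mills-summit-bearing (barriers `FixedCouplingUltralocality`, `PerturbativeInvisibility`).
Pure `2 × 2` matrix algebra over a commutative ring; this file certifies no number.

## Content

For `A, B ∈ SL(2, R)` (`R` any commutative ring) the `R`-span of `1, A, B, AB` is closed under left
multiplication by `A^{±1}, B^{±1}`, with structure constants that are polynomials in
`a = tr A`, `b = tr B`, `c = tr AB` (Cayley–Hamilton `A² = aA − 1` — the tree's `matrixTwo_mul_self` — and its
polarisation `BA = −AB + bA + aB + (c − ab)·1`).  Hence (constructively):

* `frickeCoeffs a b c ℓ : Fin 4 → R` — explicit coefficients, computed from the letter list `ℓ` by a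
  linear recursion in `a, b, c` only; ★★ `wordVal_eq_frickeSpan` — `w(A,B) = x₀·1 + x₁·A + x₂·B + x₃·AB`
  with `x = frickeCoeffs (tr A) (tr B) (tr AB) w`; ★★★ `trace_wordVal_eq` — **FRICKE–KLEIN**:
  `tr w(A,B) = 2x₀ + a x₁ + b x₂ + c x₃` is a function of `(tr A, tr B, tr AB)` alone
  (`trace_wordVal_eq_of_traces_eq`: two pairs in `SL(2,R)` with the same three traces have the same
  trace on EVERY word);
* ★★ `trace_lift_inv_eq` — the pair `(A⁻¹, B⁻¹)` has the same three traces, so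
  `tr w(A⁻¹,B⁻¹) = tr w(A,B)` for all `w ∈ F₂` in `Matrix.SpecialLinearGroup (Fin 2) R`, ANY
  commutative `R` (Kapovich–Levitt–Schupp–Shpilrain 2007, Prop. 5.3, their proof; part 1 proved the
  `SU(2)` case differently, by an explicit simultaneous conjugator, which does not exist over general `R`).

In print: Fricke–Klein, *Vorlesungen über die Theorie der automorphen Functionen* I (1897); Horowitz,
Comm. Pure Appl. Math. 25 (1972) 635–649; Kapovich–Levitt–Schupp–Shpilrain, Trans. AMS 359 (2007),
arXiv:math/0409284, Lemma 5.1 / Prop. 5.3.  Mathlib has `Matrix.SpecialLinearGroup`, `FreeGroup.lift`;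
no trace polynomials.  [folklore]
-/

namespace Summit.QuantumFields.GaugeBoot

namespace Fricke

open Matrix

variable {R : Type*} [CommRing R]

/-! ## `2 × 2` Cayley–Hamilton identities -/

-- Cayley–Hamilton for `2 × 2` matrices, `A² = (tr A)·A − (det A)·1`, is the tree's
-- `Literature.NumberTheory.Automorphic.matrixTwo_mul_self` (reused, not restated).

/-- **Polarised Cayley–Hamilton**: `BA = −AB + (tr B)·A + (tr A)·B + (tr(AB) − tr A tr B)·1` for all
`2 × 2` matrices. [folklore] -/
theorem mul_comm_eq (A B : Matrix (Fin 2) (Fin 2) R) :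
    B * A = -(A * B) + B.trace • A + A.trace • B + ((A * B).trace - A.trace * B.trace) • (1 : Matrix (Fin 2) (Fin 2) R) := by
  rw [Matrix.trace_fin_two, Matrix.trace_fin_two, Matrix.trace_fin_two]
  ext i j
  fin_cases i <;> fin_cases j <;> simp [Matrix.mul_apply, Fin.sum_univ_two] <;> ring

/-- The adjugate of a `2 × 2` matrix is `(tr A)·1 − A`. [folklore] -/
theorem adjugate_eq (A : Matrix (Fin 2) (Fin 2) R) : A.adjugate = A.trace • (1 : Matrix (Fin 2) (Fin 2) R) - A := by
  rw [Matrix.adjugate_fin_two, Matrix.trace_fin_two]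
  ext i j
  fin_cases i <;> fin_cases j <;> simp

/-- `tr (adj A) = tr A` (`2 × 2`). [folklore] -/
theorem trace_adjugate_eq (A : Matrix (Fin 2) (Fin 2) R) : A.adjugate.trace = A.trace := by
  rw [Matrix.adjugate_fin_two, Matrix.trace_fin_two, Matrix.trace_fin_two]
  simp [add_comm]

/-- `tr (adj A · adj B) = tr (A B)` (`adj A adj B = adj (BA)` and `tr adj = tr`, `tr BA = tr AB`). [folklore] -/
theorem trace_adjugate_mul_adjugate (A B : Matrix (Fin 2) (Fin 2) R) : (A.adjugate * B.adjugate).trace = (A * B).trace := by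
  rw [← Matrix.adjugate_mul_distrib, trace_adjugate_eq, Matrix.trace_mul_comm]

/-! ## The Fricke span `{1, A, B, AB}` and its structure constants -/

/-- The element `x₀·1 + x₁·A + x₂·B + x₃·AB` of the Fricke span. [folklore] -/
def span (A B : Matrix (Fin 2) (Fin 2) R) (x : Fin 4 → R) : Matrix (Fin 2) (Fin 2) R :=
  x 0 • (1 : Matrix (Fin 2) (Fin 2) R) + x 1 • A + x 2 • B + x 3 • (A * B)

/-- Left multiplication by `A` on coefficients (`a = tr A`): `A·1 = A`, `A·A = aA − 1`, `A·B = AB`,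
`A·AB = aAB − B`. [folklore] -/
def stepA (a : R) (x : Fin 4 → R) : Fin 4 → R := ![-x 1, x 0 + a * x 1, -x 3, x 2 + a * x 3]

/-- Left multiplication by `B` on coefficients (`a, b, c = tr A, tr B, tr AB`): `B·1 = B`,
`B·A = −AB + bA + aB + (c − ab)1`, `B·B = bB − 1`, `B·AB = A + cB − a1`. [folklore] -/
def stepB (a b c : R) (x : Fin 4 → R) : Fin 4 → R :=
  ![x 1 * (c - a * b) - x 2 - a * x 3, b * x 1 + x 3, x 0 + a * x 1 + b * x 2 + c * x 3, -x 1]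

/-- Left multiplication by a letter `A^{±1}`, `B^{±1}` on coefficients (inverse letters act by
`adj X = (tr X)·1 − X`). [folklore] -/
def step (a b c : R) : Fin 2 × Bool → (Fin 4 → R) → (Fin 4 → R)
  | (i, s), x => if i = 0 then (if s then stepA a x else a • x - stepA a x)
      else (if s then stepB a b c x else b • x - stepB a b c x)

/-- **The Fricke coefficients of a word**: `w(A,B) = Σ xᵢ eᵢ` with `x = frickeCoeffs a b c w` computed
from the letters alone (a linear recursion in `a, b, c`). [folklore] -/
def frickeCoeffs (a b c : R) : List (Fin 2 × Bool) → Fin 4 → R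
  | [] => ![1, 0, 0, 0]
  | y :: ℓ => step a b c y (frickeCoeffs a b c ℓ)

/-- The value of a letter: `A`, `adj A`, `B`, `adj B`. [folklore] -/
def lval (A B : Matrix (Fin 2) (Fin 2) R) : Fin 2 × Bool → Matrix (Fin 2) (Fin 2) R
  | (i, s) => if i = 0 then (if s then A else A.adjugate) else (if s then B else B.adjugate)

/-- The value of a word: the ordered product of its letter values. [folklore] -/
def wordVal (A B : Matrix (Fin 2) (Fin 2) R) (ℓ : List (Fin 2 × Bool)) : Matrix (Fin 2) (Fin 2) R := (ℓ.map (lval A B)).prod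

section Closure

variable {A B : Matrix (Fin 2) (Fin 2) R}

/-- `A · span x = span (stepA x)` (`det A = 1`). [folklore] -/
theorem mul_span_A (hA : A.det = 1) (x : Fin 4 → R) : A * span A B x = span A B (stepA A.trace x) := by
  have hAA : A * A = A.trace • A - (1 : Matrix (Fin 2) (Fin 2) R) := by rw [Literature.NumberTheory.Automorphic.matrixTwo_mul_self, hA, one_smul]
  have hAAB : A * (A * B) = A.trace • (A * B) - B := by rw [← mul_assoc, hAA, sub_mul, smul_mul_assoc, one_mul]
  simp only [span, stepA, mul_add, mul_smul_comm, mul_one, hAA, hAAB, Matrix.cons_val_zero, Matrix.cons_val_one,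
    Matrix.cons_val]
  module

/-- `B · span x = span (stepB x)` (`det B = 1`). [folklore] -/
theorem mul_span_B (hB : B.det = 1) (x : Fin 4 → R) : B * span A B x = span A B (stepB A.trace B.trace (A * B).trace x) := by
  have hBB : B * B = B.trace • B - (1 : Matrix (Fin 2) (Fin 2) R) := by rw [Literature.NumberTheory.Automorphic.matrixTwo_mul_self, hB, one_smul]
  have hBA := mul_comm_eq A B
  have hBAB : B * (A * B) = A + (A * B).trace • B - A.trace • (1 : Matrix (Fin 2) (Fin 2) R) := by
    rw [← mul_assoc, hBA]
    simp only [add_mul, neg_mul, smul_mul_assoc, one_mul, mul_assoc, hBB, mul_sub, mul_one, mul_smul_comm]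
    module
  simp only [span, stepB, mul_add, mul_smul_comm, mul_one, hBB, hBA, hBAB, Matrix.cons_val_zero, Matrix.cons_val_one,
    Matrix.cons_val]
  module

/-- Scalars pass into the coefficients of the span. [folklore] -/
theorem smul_span (r : R) (x : Fin 4 → R) : r • span A B x = span A B (r • x) := by
  simp only [span, Pi.smul_apply, smul_eq_mul, smul_add, smul_smul]

/-- Each letter maps the span to itself with the stated structure constants (`det A = det B = 1`). [folklore] -/
theorem lval_mul_span (hA : A.det = 1) (hB : B.det = 1) (y : Fin 2 × Bool) (x : Fin 4 → R) :
    lval A B y * span A B x = span A B (step A.trace B.trace (A * B).trace y x) := by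
  obtain ⟨i, s⟩ := y
  fin_cases i <;> cases s
  · show A.adjugate * span A B x = span A B (A.trace • x - stepA A.trace x)
    rw [adjugate_eq, sub_mul, smul_mul_assoc, one_mul, mul_span_A hA, smul_span]
    simp only [span, Pi.sub_apply, sub_smul]
    abel
  · exact mul_span_A hA x
  · show B.adjugate * span A B x = span A B (B.trace • x - stepB A.trace B.trace (A * B).trace x)
    rw [adjugate_eq, sub_mul, smul_mul_assoc, one_mul, mul_span_B hB, smul_span]
    simp only [span, Pi.sub_apply, sub_smul]
    abel
  · exact mul_span_B hB x

/-- ★★ **Every word lies in the Fricke span, with coefficients `frickeCoeffs (tr A) (tr B) (tr AB) w`**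
(`det A = det B = 1`). [folklore] -/
theorem wordVal_eq_span (hA : A.det = 1) (hB : B.det = 1) : ∀ ℓ : List (Fin 2 × Bool),
    wordVal A B ℓ = span A B (frickeCoeffs A.trace B.trace (A * B).trace ℓ)
  | [] => by simp [wordVal, span, frickeCoeffs]
  | y :: ℓ => by
    rw [wordVal, List.map_cons, List.prod_cons, ← wordVal, wordVal_eq_span hA hB ℓ, lval_mul_span hA hB, frickeCoeffs]

/-- The trace of an element of the span: `2x₀ + a x₁ + b x₂ + c x₃`. [folklore] -/
theorem trace_span (x : Fin 4 → R) :
    (span A B x).trace = 2 * x 0 + A.trace * x 1 + B.trace * x 2 + (A * B).trace * x 3 := by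
  simp only [span, Matrix.trace_add, Matrix.trace_smul, Matrix.trace_one, Fintype.card_fin, smul_eq_mul]
  push_cast
  ring

/-- ★★★ **Fricke–Klein**: `tr w(A,B) = 2x₀ + (tr A)x₁ + (tr B)x₂ + (tr AB)x₃` with `x` the Fricke
coefficients of `w` at `(tr A, tr B, tr AB)` — a function of the three traces alone (`det A = det B = 1`). [folklore] -/
theorem trace_wordVal_eq (hA : A.det = 1) (hB : B.det = 1) (ℓ : List (Fin 2 × Bool)) :
    (wordVal A B ℓ).trace = 2 * frickeCoeffs A.trace B.trace (A * B).trace ℓ 0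
      + A.trace * frickeCoeffs A.trace B.trace (A * B).trace ℓ 1
      + B.trace * frickeCoeffs A.trace B.trace (A * B).trace ℓ 2
      + (A * B).trace * frickeCoeffs A.trace B.trace (A * B).trace ℓ 3 := by
  rw [wordVal_eq_span hA hB, trace_span]

end Closure

/-- ★★★ **Two pairs in `SL(2, R)` with the same `(tr A, tr B, tr AB)` have the same trace on every word.**
[folklore] -/
theorem trace_wordVal_eq_of_traces_eq {A B A' B' : Matrix (Fin 2) (Fin 2) R} (hA : A.det = 1) (hB : B.det = 1)
    (hA' : A'.det = 1) (hB' : B'.det = 1) (ha : A'.trace = A.trace) (hb : B'.trace = B.trace)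
    (hc : (A' * B').trace = (A * B).trace) (ℓ : List (Fin 2 × Bool)) :
    (wordVal A' B' ℓ).trace = (wordVal A B ℓ).trace := by
  rw [trace_wordVal_eq hA hB, trace_wordVal_eq hA' hB', ha, hb, hc]

/-- ★★ **The inverse pair**: `tr w(adj A, adj B) = tr w(A, B)` for `A, B ∈ SL(2, R)` — `(A⁻¹, B⁻¹)` has the
same three traces. [folklore] -/
theorem trace_wordVal_adjugate (A B : Matrix (Fin 2) (Fin 2) R) (hA : A.det = 1) (hB : B.det = 1) (ℓ : List (Fin 2 × Bool)) :
    (wordVal A.adjugate B.adjugate ℓ).trace = (wordVal A B ℓ).trace :=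
  trace_wordVal_eq_of_traces_eq hA hB (by rw [Matrix.det_adjugate, hA, one_pow]) (by rw [Matrix.det_adjugate, hB, one_pow])
    (trace_adjugate_eq A) (trace_adjugate_eq B) (trace_adjugate_mul_adjugate A B) ℓ

/-! ## `Matrix.SpecialLinearGroup (Fin 2) R` and `FreeGroup.lift` -/

/-- The word value in `SL(2,R)` is Mathlib's `FreeGroup.lift` evaluation (inverse = adjugate). [folklore] -/
theorem coe_lift_mk (f : Fin 2 → Matrix.SpecialLinearGroup (Fin 2) R) (ℓ : List (Fin 2 × Bool)) :
    ((FreeGroup.lift f (FreeGroup.mk ℓ) : Matrix.SpecialLinearGroup (Fin 2) R) : Matrix (Fin 2) (Fin 2) R) =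
      wordVal (f 0 : Matrix (Fin 2) (Fin 2) R) (f 1) ℓ := by
  rw [FreeGroup.lift_mk]
  induction ℓ with
  | nil => simp [wordVal]
  | cons y ℓ ih =>
    rw [List.map_cons, List.prod_cons, Matrix.SpecialLinearGroup.coe_mul, wordVal, List.map_cons, List.prod_cons,
      ← wordVal, ih]
    congr 1
    obtain ⟨i, s⟩ := y
    fin_cases i <;> cases s <;> simp [lval, Matrix.SpecialLinearGroup.coe_inv]

/-- Inverting the generators turns `FreeGroup.mk ℓ` at `f` into the word value at `(adj f 0, adj f 1)`. [folklore] -/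
theorem coe_lift_inv_mk (f : Fin 2 → Matrix.SpecialLinearGroup (Fin 2) R) (ℓ : List (Fin 2 × Bool)) :
    ((FreeGroup.lift (fun i => (f i)⁻¹) (FreeGroup.mk ℓ) : Matrix.SpecialLinearGroup (Fin 2) R) : Matrix (Fin 2) (Fin 2) R) =
      wordVal (f 0 : Matrix (Fin 2) (Fin 2) R).adjugate (f 1 : Matrix (Fin 2) (Fin 2) R).adjugate ℓ := by
  rw [coe_lift_mk]
  simp only [Matrix.SpecialLinearGroup.coe_inv]

/-- ★★★ **Fricke–Klein–Horowitz over any commutative ring**: for `f : Fin 2 → SL(2, R)` and every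
`w ∈ F₂`, `tr w(f⁻¹) = tr w(f)` (Kapovich–Levitt–Schupp–Shpilrain 2007, Prop. 5.3). [folklore] -/
theorem trace_lift_inv_eq (f : Fin 2 → Matrix.SpecialLinearGroup (Fin 2) R) (w : FreeGroup (Fin 2)) :
    ((FreeGroup.lift (fun i => (f i)⁻¹) w : Matrix.SpecialLinearGroup (Fin 2) R) : Matrix (Fin 2) (Fin 2) R).trace =
      ((FreeGroup.lift f w : Matrix.SpecialLinearGroup (Fin 2) R) : Matrix (Fin 2) (Fin 2) R).trace := by
  obtain ⟨ℓ, rfl⟩ : ∃ ℓ, FreeGroup.mk ℓ = w := ⟨w.toWord, FreeGroup.mk_toWord⟩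
  rw [coe_lift_inv_mk, coe_lift_mk]
  exact trace_wordVal_adjugate _ _ (f 0).2 (f 1).2 ℓ

end Fricke

end Summit.QuantumFields.GaugeBoot
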